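import Literature.ModelTheory.ExponentialFields.PartialDerivWords
import Mathlib.Analysis.Calculus.ContDiff.Bounds
import Mathlib.Analysis.Calculus.IteratedDeriv.Lemmas
import HarnessLib

/-!
# Word-partial tools for the change of the last variable (Bhardwaj–van den Dries 2022, Cor. 6.4)

Topic `Literature/ModelTheory/ExponentialFields`; proof file in the cone of the named fact
`PilaWilkie2006_thm_1_8`.  Bookkeeping for Bhardwaj–van den Dries 2022, Cor. 6.4 (iterated
application of Lemma 6.2 to all partials `f_φ^{(α)}`), in the word formalism of
`PartialDerivWords`:

* `pderiv_castSucc_eq_section`, `pderivWord_map_castSucc_eq_section` — horizontal (word)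
  partials are (word) partials of the sections `y ↦ F(y, t)`;
* `pderivWord_map_castSucc_comp_changeLast` — horizontal words commute with `I_ψ`;
* `pderivWord_replicate_append` — `∂_{m+1}^j ∂^{w↑} K` as an iterated derivative of a section;
* `iteratedDeriv_comp_bounds` — the one-variable recursion giving bounds for
  `(h ∘ ψ)^{(i)}` from bounds on the `h^{(r)}` and on the first derivatives `(h^{(r)} ∘ ψ)'`
  (replacing the Faà di Bruno polynomials of Lemma 4.5 in the printed proof by the Leibniz
  bound `norm_iteratedFDerivWithin_mul_le`).

Nothing here is a named fact; no definitions.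

## References

* N. Bhardwaj, L. van den Dries, *On the Pila–Wilkie theorem*, Expo. Math. 40 (2022), §6,
  Cor. 6.4 and its proof; Lemma 4.5. [BhardwajVanDenDries2022]
-/

noncomputable section

open Set Filter Topology Function

namespace Literature.ModelTheory.ExponentialFields

/-! ### Horizontal words: sections and the change of the last variable -/

section HorizontalWords

variable {m : ℕ}

/-- `snoc (update y i s) t = update (snoc y t) (castSucc i) s`. [folklore] -/
theorem snoc_update_eq_update_snoc (y : Fin m → ℝ) (t : ℝ) (i : Fin m) (s : ℝ) :
    (Fin.snoc (Function.update y i s) t : Fin (m + 1) → ℝ) = Function.update (Fin.snoc y t) (Fin.castSucc i) s := by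
  ext l
  refine Fin.lastCases ?_ (fun j => ?_) l
  · rw [Fin.snoc_last, Function.update_of_ne (Fin.castSucc_lt_last i).ne', Fin.snoc_last]
  · rw [Fin.snoc_castSucc]
    by_cases h : j = i
    · subst h; simp
    · rw [Function.update_of_ne h, Function.update_of_ne (fun h' => h (Fin.castSucc_injective _ h')), Fin.snoc_castSucc]

/-- A horizontal partial of `G` at `x` is the partial of the section `y ↦ G(y, x_{m+1})` at
`x' = init x`. [folklore] -/
theorem pderiv_castSucc_eq_section {G : (Fin (m + 1) → ℝ) → ℝ} {x : Fin (m + 1) → ℝ}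
    (hG : DifferentiableAt ℝ G x) (i : Fin m) :
    pderiv (Fin.castSucc i) G x = pderiv i (fun y : Fin m → ℝ => G (Fin.snoc y (x (Fin.last m)))) (Fin.init x) := by
  have hsec : (fun y : Fin m → ℝ => (Fin.snoc y (x (Fin.last m)) : Fin (m + 1) → ℝ)) =
      fun y => (fun l => (Fin.snoc y (0 : ℝ) : Fin (m + 1) → ℝ) l) + (Pi.single (Fin.last m) (x (Fin.last m))) := by
    funext y; ext l
    refine Fin.lastCases ?_ (fun j => ?_) l <;> simp
  have hlin : Differentiable ℝ (fun y : Fin m → ℝ => (Fin.snoc y (x (Fin.last m)) : Fin (m + 1) → ℝ)) := by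
    refine differentiable_pi.mpr fun l => ?_
    refine Fin.lastCases ?_ (fun j => ?_) l
    · simp only [Fin.snoc_last]; exact differentiable_const _
    · simp only [Fin.snoc_castSucc]; exact differentiable_apply j
  have hx : (Fin.snoc (Fin.init x) (x (Fin.last m)) : Fin (m + 1) → ℝ) = x := Fin.snoc_init_self x
  have hGs : DifferentiableAt ℝ (fun y : Fin m → ℝ => G (Fin.snoc y (x (Fin.last m)))) (Fin.init x) := by
    have : DifferentiableAt ℝ G (Fin.snoc (Fin.init x) (x (Fin.last m))) := by rw [hx]; exact hG
    exact DifferentiableAt.comp (Fin.init x) (g := G)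
      (f := fun y : Fin m → ℝ => (Fin.snoc y (x (Fin.last m)) : Fin (m + 1) → ℝ)) this (hlin _)
  rw [pderiv_eq_deriv_section hG, pderiv_eq_deriv_section hGs]
  simp only [snoc_update_eq_update_snoc, hx]
  rfl

/-- **Horizontal word partials are word partials of the sections**: on an open `O`, for `F`
of class `C^{|w|}`, `∂^{w↑} F (x) = ∂^w (F(·, x_{m+1}))(x')`, `w↑` the word `w` read in
`ℝ^{m+1}`. [folklore] -/
theorem pderivWord_map_castSucc_eq_section {O : Set (Fin (m + 1) → ℝ)} (hO : IsOpen O) :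
    ∀ (w : List (Fin m)) {F : (Fin (m + 1) → ℝ) → ℝ}, ContDiffOn ℝ (w.length : WithTop ℕ∞) F O →
      ∀ {x}, x ∈ O → pderivWord (w.map Fin.castSucc) F x =
        pderivWord w (fun y : Fin m → ℝ => F (Fin.snoc y (x (Fin.last m)))) (Fin.init x)
  | [], F, _, x, _ => by simp [Fin.snoc_init_self]
  | i :: w, F, hF, x, hx => by
    rw [List.map_cons, pderivWord_cons, pderivWord_cons]
    -- `∂^{w↑} F` is `C¹` on `O`
    have hF' : ContDiffOn ℝ (((1 : ℕ) + (w.map Fin.castSucc).length : ℕ) : WithTop ℕ∞) F O := by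
      rw [List.length_map, Nat.add_comm 1 w.length]; simpa only [List.length_cons] using hF
    have hW : ContDiffOn ℝ 1 (pderivWord (w.map Fin.castSucc) F) O := by
      have := ContDiffOn.pderivWord hO (w.map Fin.castSucc) hF'; exact_mod_cast this
    have hWd : DifferentiableAt ℝ (pderivWord (w.map Fin.castSucc) F) x :=
      (hW.differentiableOn one_ne_zero x hx).differentiableAt (hO.mem_nhds hx)
    rw [pderiv_castSucc_eq_section hWd]
    -- the sections agree on the open fibre `{y | (y, x_{m+1}) ∈ O}`
    have hfib : IsOpen {y : Fin m → ℝ | (Fin.snoc y (x (Fin.last m)) : Fin (m + 1) → ℝ) ∈ O} := by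
      refine hO.preimage (continuous_pi fun l => ?_)
      refine Fin.lastCases ?_ (fun j => ?_) l
      · simp only [Fin.snoc_last]; exact continuous_const
      · simp only [Fin.snoc_castSucc]; exact continuous_apply j
    have hmem : Fin.init x ∈ {y : Fin m → ℝ | (Fin.snoc y (x (Fin.last m)) : Fin (m + 1) → ℝ) ∈ O} := by
      show (Fin.snoc (Fin.init x) (x (Fin.last m)) : Fin (m + 1) → ℝ) ∈ O
      rw [Fin.snoc_init_self]; exact hx
    refine pderiv_congr_of_eqOn hfib (fun y hy => ?_) i hmem
    have hwF : ContDiffOn ℝ (w.length : WithTop ℕ∞) F O :=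
      hF.of_le (by rw [List.length_cons]; exact_mod_cast Nat.le_succ _)
    have h := pderivWord_map_castSucc_eq_section hO w hwF hy
    simp only [Fin.snoc_last, Fin.init_snoc] at h
    exact h

/-- **Horizontal words commute with the change of the last variable**: on an open `O` mapped
by `I_ψ` into an open `O'` on which `K` is `C^{|w|}`, with `ψ` differentiable at the last
coordinates of points of `O`, `∂^{w↑}(K ∘ I_ψ) = (∂^{w↑} K) ∘ I_ψ` on `O`. [folklore] -/
theorem pderivWord_map_castSucc_comp_changeLast {O O' : Set (Fin (m + 1) → ℝ)} (hO : IsOpen O) (hO' : IsOpen O')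
    {ψ : ℝ → ℝ} (hψ : ∀ x ∈ O, DifferentiableAt ℝ ψ (x (Fin.last m)))
    (hmaps : MapsTo (fun x : Fin (m + 1) → ℝ => Function.update x (Fin.last m) (ψ (x (Fin.last m)))) O O') :
    ∀ (w : List (Fin m)) {K : (Fin (m + 1) → ℝ) → ℝ}, ContDiffOn ℝ (w.length : WithTop ℕ∞) K O' →
      EqOn (pderivWord (w.map Fin.castSucc) (fun x => K (Function.update x (Fin.last m) (ψ (x (Fin.last m))))))
        (fun x => pderivWord (w.map Fin.castSucc) K (Function.update x (Fin.last m) (ψ (x (Fin.last m))))) O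
  | [], K, _ => fun x _ => rfl
  | i :: w, K, hK => by
    intro x hx
    rw [List.map_cons, pderivWord_cons, pderivWord_cons]
    have hwK : ContDiffOn ℝ (w.length : WithTop ℕ∞) K O' :=
      hK.of_le (by rw [List.length_cons]; exact_mod_cast Nat.le_succ _)
    have ih := pderivWord_map_castSucc_comp_changeLast hO hO' hψ hmaps w hwK
    rw [pderiv_congr_of_eqOn hO ih (Fin.castSucc i) hx]
    -- `∂^{w↑} K` is `C¹` on `O'`
    have hK' : ContDiffOn ℝ (((1 : ℕ) + (w.map Fin.castSucc).length : ℕ) : WithTop ℕ∞) K O' := by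
      rw [List.length_map, Nat.add_comm 1 w.length]; simpa only [List.length_cons] using hK
    have hW : ContDiffOn ℝ 1 (pderivWord (w.map Fin.castSucc) K) O' := by
      have := ContDiffOn.pderivWord hO' (w.map Fin.castSucc) hK'; exact_mod_cast this
    have hWd : DifferentiableAt ℝ (pderivWord (w.map Fin.castSucc) K) (Function.update x (Fin.last m) (ψ (x (Fin.last m)))) :=
      (hW.differentiableOn one_ne_zero _ (hmaps hx)).differentiableAt (hO'.mem_nhds (hmaps hx))
    exact pderiv_comp_changeLast_of_ne hWd (hψ x hx) (Fin.castSucc_lt_last i).ne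

/-- Words with `j` letters `last` in front of a horizontal word: the iterated derivative of the
section of the horizontal partial. [folklore] -/
theorem pderivWord_replicate_append {O : Set (Fin (m + 1) → ℝ)} (hO : IsOpen O) (j : ℕ) (w : List (Fin m))
    {K : (Fin (m + 1) → ℝ) → ℝ} (hK : ContDiffOn ℝ ((j + w.length : ℕ) : WithTop ℕ∞) K O) {x : Fin (m + 1) → ℝ}
    (hx : x ∈ O) :
    pderivWord (List.replicate j (Fin.last m) ++ w.map Fin.castSucc) K x =
      iteratedDeriv j (fun s => pderivWord (w.map Fin.castSucc) K (Function.update x (Fin.last m) s)) (x (Fin.last m)) := by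
  rw [pderivWord_append]
  have hW : ContDiffOn ℝ (j : WithTop ℕ∞) (pderivWord (w.map Fin.castSucc) K) O := by
    have hK' : ContDiffOn ℝ ((j + (w.map Fin.castSucc).length : ℕ) : WithTop ℕ∞) K O := by
      rwa [List.length_map]
    exact ContDiffOn.pderivWord hO (w.map Fin.castSucc) hK'
  exact pderivWord_replicate_last hO j hW hx

end HorizontalWords

/-! ### The one-variable recursion behind Bhardwaj–van den Dries 2022, Cor. 6.4 -/

section Recursion

/-- **Higher derivatives of `h ∘ ψ` from first derivatives of all `h^{(r)} ∘ ψ`** (the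
induction closing the proof of Bhardwaj–van den Dries 2022, Cor. 6.4, done without the
Faà di Bruno polynomials `p_{ij}` of their Lemma 4.5: *"Since the `∂^i f_φ^{(β)}/∂x_{m+1}^i`
are strongly bounded on `V_l` and `ψ^{(1)},…,ψ^{(k)}` are strongly bounded on `(0,1)`,
`f_θ^{(α)}` is strongly bounded on `V_{l+1}`"*).  Data: `ψ` of class `C^k` on an open `J`
mapping into an open `J'` with `|ψ^{(q)}| ≤ 1` (`1 ≤ q ≤ k`); functions `h_r` (`r + e ≤ k`) of
class `C^{k−r−e}` on `J'` with `h_r' = h_{r+1}`, `|h_r| ≤ B` (`r ≤ l`) and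
`|(h_r ∘ ψ)'| ≤ B'` (`r ≤ l`, `r + e ≤ k − 1`).  Conclusion: `|(h_r ∘ ψ)^{(i)}| ≤ C_i` for
`i ≥ 1`, `i + r ≤ l + 1`, `i + r + e ≤ k`, with constants `C_i` depending only on
`k, B, B'` — by `(h_r ∘ ψ)^{(i)} = (ψ' · (h_{r+1} ∘ ψ))^{(i−1)}` and the Leibniz bound.
[cite: BhardwajVanDenDries2022, Cor. 6.4 (proof)] -/
theorem iteratedDeriv_comp_bounds (k l e : ℕ) (B B' : ℝ) (hB : 0 ≤ B) (hB' : 0 ≤ B') :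
    ∃ C : ℕ → ℝ, (∀ i, 0 ≤ C i) ∧ ∀ {J J' : Set ℝ}, IsOpen J → IsOpen J' → ∀ (ψ : ℝ → ℝ) (h : ℕ → ℝ → ℝ),
      ContDiffOn ℝ k ψ J → MapsTo ψ J J' →
      (∀ q, 1 ≤ q → q ≤ k → ∀ t ∈ J, |iteratedDerivWithin q ψ J t| ≤ 1) →
      (∀ r, r + e ≤ k → ContDiffOn ℝ ((k - r - e : ℕ) : WithTop ℕ∞) (h r) J') →
      (∀ r, r + e < k → ∀ y ∈ J', derivWithin (h r) J' y = h (r + 1) y) →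
      (∀ r, r ≤ l → r + e ≤ k → ∀ y ∈ J', |h r y| ≤ B) →
      (∀ r, r ≤ l → r + e + 1 ≤ k → ∀ t ∈ J, |derivWithin (fun t => h r (ψ t)) J t| ≤ B') →
      ∀ i r, 1 ≤ i → i + r ≤ l + 1 → i + r + e ≤ k → ∀ t ∈ J,
        |iteratedDerivWithin i (fun t => h r (ψ t)) J t| ≤ C i := by
  -- induction on an upper bound `N` for `i`
  suffices hN : ∀ N : ℕ, ∃ C : ℕ → ℝ, (∀ i, 0 ≤ C i) ∧ ∀ {J J' : Set ℝ}, IsOpen J → IsOpen J' →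
      ∀ (ψ : ℝ → ℝ) (h : ℕ → ℝ → ℝ),
      ContDiffOn ℝ k ψ J → MapsTo ψ J J' →
      (∀ q, 1 ≤ q → q ≤ k → ∀ t ∈ J, |iteratedDerivWithin q ψ J t| ≤ 1) →
      (∀ r, r + e ≤ k → ContDiffOn ℝ ((k - r - e : ℕ) : WithTop ℕ∞) (h r) J') →
      (∀ r, r + e < k → ∀ y ∈ J', derivWithin (h r) J' y = h (r + 1) y) →
      (∀ r, r ≤ l → r + e ≤ k → ∀ y ∈ J', |h r y| ≤ B) →
      (∀ r, r ≤ l → r + e + 1 ≤ k → ∀ t ∈ J, |derivWithin (fun t => h r (ψ t)) J t| ≤ B') →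
      ∀ i r, 1 ≤ i → i ≤ N → i + r ≤ l + 1 → i + r + e ≤ k → ∀ t ∈ J,
        |iteratedDerivWithin i (fun t => h r (ψ t)) J t| ≤ C i by
    obtain ⟨C, hC0, hC⟩ := hN k
    exact ⟨C, hC0, fun hJ hJ' ψ h h1 h2 h3 h4 h5 h6 h7 i r hi hirl hire t ht =>
      hC hJ hJ' ψ h h1 h2 h3 h4 h5 h6 h7 i r hi (by omega) hirl hire t ht⟩
  intro N
  induction N with
  | zero => exact ⟨fun _ => 0, fun _ => le_rfl, fun _ _ _ _ _ _ _ _ _ _ _ i r hi hiN => by omega⟩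
  | succ N ih =>
    obtain ⟨C, hC0, hC⟩ := ih
    -- the new constant for order `N + 1`
    set cNew : ℝ := (∑ q ∈ Finset.range N, ((N.choose q : ℕ) : ℝ) * C (N - q)) + B + B' with hcNew
    have hcNew0 : 0 ≤ cNew := by
      have : 0 ≤ ∑ q ∈ Finset.range N, ((N.choose q : ℕ) : ℝ) * C (N - q) :=
        Finset.sum_nonneg fun q _ => mul_nonneg (by positivity) (hC0 _)
      rw [hcNew]; linarith
    refine ⟨fun i => if i ≤ N then C i else cNew, fun i => by
      simp only; split_ifs
      · exact hC0 i
      · exact hcNew0, ?_⟩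
    intro J J' hJ hJ' ψ h hψ hmaps hψbd hh hh' hhB hhB' i r hi hiN hirl hire t ht
    by_cases hiN' : i ≤ N
    · simp only [hiN', if_true]
      exact hC hJ hJ' ψ h hψ hmaps hψbd hh hh' hhB hhB' i r hi hiN' hirl hire t ht
    have hi_eq : i = N + 1 := by omega
    simp only [hiN', if_false]
    subst hi_eq
    have hJu : UniqueDiffOn ℝ J := hJ.uniqueDiffOn
    rcases Nat.eq_zero_or_pos N with hN0 | hNpos
    · -- `i = 1`: the hypothesis `hhB'`
      subst hN0
      simp only [zero_add, iteratedDerivWithin_one]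
      have := hhB' r (by omega) (by omega) t ht
      rw [hcNew]
      have : (0 : ℝ) ≤ ∑ q ∈ Finset.range 0, ((Nat.choose 0 q : ℕ) : ℝ) * C (0 - q) := by simp
      linarith
    -- `i = N + 1 ≥ 2`: `(h_r ∘ ψ)^{(N+1)} = (ψ' · (h_{r+1} ∘ ψ))^{(N)}`
    have hre : r + e < k := by omega
    -- smoothness of the pieces on `J`
    have hhr1 : ContDiffOn ℝ ((k - (r + 1) - e : ℕ) : WithTop ℕ∞) (h (r + 1)) J' := hh (r + 1) (by omega)
    have hcomp1 : ContDiffOn ℝ ((k - (r + 1) - e : ℕ) : WithTop ℕ∞) (fun t => h (r + 1) (ψ t)) J :=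
      hhr1.comp (hψ.of_le (by exact_mod_cast (show k - (r + 1) - e ≤ k by omega))) hmaps
    have hψ' : ContDiffOn ℝ ((k - (r + 1) - e : ℕ) : WithTop ℕ∞) (derivWithin ψ J) J :=
      hψ.derivWithin hJu (by exact_mod_cast (show k - (r + 1) - e + 1 ≤ k by omega))
    -- the first derivative on `J`
    have hderiv : EqOn (derivWithin (fun t => h r (ψ t)) J) (fun t => derivWithin ψ J t * h (r + 1) (ψ t)) J := by
      intro y hy
      have hhd : DifferentiableWithinAt ℝ (h r) J' (ψ y) :=
        (hh r (by omega)).differentiableOn (by exact_mod_cast (show (k - r - e : ℕ) ≠ 0 by omega)) _ (hmaps hy)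
      have hψd : DifferentiableWithinAt ℝ ψ J y :=
        hψ.differentiableOn (by exact_mod_cast (show (k : ℕ) ≠ 0 by omega)) _ hy
      have hc := hhd.hasDerivWithinAt.comp y hψd.hasDerivWithinAt hmaps
      rw [show (fun t => h r (ψ t)) = h r ∘ ψ from rfl, hc.derivWithin (hJu y hy), hh' r hre _ (hmaps hy)]
      ring
    rw [iteratedDerivWithin_succ', iteratedDerivWithin_congr (n := N) hderiv ht]
    -- Leibniz bound
    have hNle : ((N : ℕ) : WithTop ℕ∞) ≤ ((k - (r + 1) - e : ℕ) : WithTop ℕ∞) := by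
      exact_mod_cast (show N ≤ k - (r + 1) - e by omega)
    have hL := norm_iteratedFDerivWithin_mul_le hψ' hcomp1 hJu ht (n := N) hNle
    simp only [norm_iteratedFDerivWithin_eq_norm_iteratedDerivWithin, Real.norm_eq_abs] at hL
    refine hL.trans ?_
    rw [Finset.sum_range_succ]
    -- the last term: `q = N`, order `0` on `h_{r+1} ∘ ψ`
    have hlast : ((N.choose N : ℕ) : ℝ) * |iteratedDerivWithin N (derivWithin ψ J) J t| *
        |iteratedDerivWithin (N - N) (fun t => h (r + 1) (ψ t)) J t| ≤ B := by
      rw [Nat.choose_self, Nat.cast_one, one_mul, Nat.sub_self, iteratedDerivWithin_zero]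
      have h1 : |iteratedDerivWithin N (derivWithin ψ J) J t| ≤ 1 := by
        rw [← iteratedDerivWithin_succ']; exact hψbd (N + 1) (by omega) (by omega) t ht
      have h2 : |h (r + 1) (ψ t)| ≤ B := hhB (r + 1) (by omega) (by omega) _ (hmaps ht)
      calc |iteratedDerivWithin N (derivWithin ψ J) J t| * |h (r + 1) (ψ t)| ≤ 1 * B :=
            mul_le_mul h1 h2 (abs_nonneg _) zero_le_one
        _ = B := one_mul B
    -- the other terms: `q < N`, orders `N - q ≥ 1` on `h_{r+1} ∘ ψ`, by the induction hypothesis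
    have hrest : ∑ q ∈ Finset.range N, ((N.choose q : ℕ) : ℝ) * |iteratedDerivWithin q (derivWithin ψ J) J t| *
        |iteratedDerivWithin (N - q) (fun t => h (r + 1) (ψ t)) J t| ≤
        ∑ q ∈ Finset.range N, ((N.choose q : ℕ) : ℝ) * C (N - q) := by
      refine Finset.sum_le_sum fun q hq => ?_
      have hqN : q < N := Finset.mem_range.mp hq
      have h1 : |iteratedDerivWithin q (derivWithin ψ J) J t| ≤ 1 := by
        rw [← iteratedDerivWithin_succ']; exact hψbd (q + 1) (by omega) (by omega) t ht
      have h2 : |iteratedDerivWithin (N - q) (fun t => h (r + 1) (ψ t)) J t| ≤ C (N - q) :=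
        hC hJ hJ' ψ h hψ hmaps hψbd hh hh' hhB hhB' (N - q) (r + 1) (by omega) (by omega) (by omega) (by omega) t ht
      calc ((N.choose q : ℕ) : ℝ) * |iteratedDerivWithin q (derivWithin ψ J) J t| *
            |iteratedDerivWithin (N - q) (fun t => h (r + 1) (ψ t)) J t|
          ≤ ((N.choose q : ℕ) : ℝ) * 1 * C (N - q) :=
            mul_le_mul (mul_le_mul_of_nonneg_left h1 (by positivity)) h2 (abs_nonneg _) (by positivity)
        _ = ((N.choose q : ℕ) : ℝ) * C (N - q) := by ring
    rw [hcNew]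
    linarith

end Recursion


end Literature.ModelTheory.ExponentialFields

end
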